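import Literature.NumberTheory.NumberFields.AbelianPExtensionCyclic
import Mathlib.GroupTheory.SpecificGroups.Cyclic
import HarnessLib

/-!
# A Galois extension of `ℚ` of odd `p`-power degree unramified outside `p` is cyclic
# («`ℚ` is `p`-rational»: the maximal pro-`p` extension of `ℚ` unramified outside `{p, ∞}` is `ℚ_∞`)

Topic `NumberTheory/NumberFields` (namespace = path).  THEOREMS ONLY (no definition, no named fact, no
instance, no `sorry`).  Written by the prover seat `bsd-eis-lam-a` g19 (cell `bsd-eis`, route
`EisensteinPrimes`, crux 5 stmt-BirchSwinnertonDyer-19035 `MazurMCOnX1RankZero`; `--supports` that item,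
closes nothing): it is the number-field input of the kernel proof of the TRIVIAL-MODULE case of Greenberg's
Lemma 5.9 (LNM 1716; the registered PUB stub `stub_publishedL59` of the line `interlude_with_torsion`),
namely that `H¹(ℚ_{{p,∞}}/ℚ_∞, ℤ/p) = 0` for an odd prime `p`
(`Literature/NumberTheory/IwasawaTheory/GreenbergCyclicOrderPTrivialProofs.lean`).

**Theorem** (`isCyclic_of_isGalois_of_isUnramifiedAt_of_card_eq_prime_pow`).  Let `p` be an odd prime
and `M/ℚ` a finite GALOIS extension of degree `p^k` (not assumed abelian) in which every prime not above
`p` is unramified.  Then `Gal(M/ℚ)` is cyclic.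

Proof (induction on `k`).  The tree already has the ABELIAN case (Marcus, *Number Fields*, Ch. 4,
Ex. 34–35: `isCyclic_of_isUnramifiedAt_of_card_eq_prime_pow`, file `AbelianPExtensionCyclic.lean`).  For a
`p`-group `G = Gal(M/ℚ)` with `k ≥ 1` the centre `Z` is non-trivial; the fixed field `M^Z` is Galois over `ℚ`
with group `G/Z` of order `p^j`, `j < k`, again unramified outside `p`, hence cyclic by induction; a group
whose quotient by its centre is cyclic is abelian (Mathlib `MonoidHom.isMulCommutative_of_isCyclic_of_ker_le_center`), so `M`
is abelian over `ℚ` and the abelian case applies.  Consequently every finite Galois `p`-extension of `ℚ`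
unramified outside `p` is a layer `ℚ_n` of the cyclotomic `ℤ_p`-extension (by the uniqueness half
`IntermediateField.eq_of_inertia_le_of_finrank_eq`), i.e. the maximal pro-`p` extension of `ℚ` unramified
outside `{p, ∞}` is `ℚ_∞` — the classical statement that `ℚ` is `p`-rational for every odd `p`
(Washington, *Introduction to Cyclotomic Fields*, proof of Thm. 13.4 / §13.1; Neukirch–Schmidt–Wingberg
(10.7.?) «`ℚ_S(p)`, `S = {p, ∞}`»; Movahhedi–Nguyen Quang Do 1990, the example `k = ℚ`).

HONEST FRAMING: elementary Galois/number theory over the tree's Marcus Ex. 34–36 files; proves no case of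
BSD; no summit statement is proved.

## References

* D. A. Marcus, *Number Fields*, 2nd ed. (2018), Ch. 4, Ex. 34–36 (pp. 102–103). [Marcus2018]
* L. C. Washington, *Introduction to Cyclotomic Fields*, 2nd ed. (1997), §13.1 and Prop. 13.2.
  [Washington1997]
* R. Greenberg, *Iwasawa theory for elliptic curves*, LNM 1716 (1999), §5 Lemma 5.9 (the consumer).
  [Greenberg1999LNM]
-/

noncomputable section

open NumberField Ideal
open scoped Pointwise IsMulCommutative

namespace Literature.NumberTheory.NumberFields

universe u

/-- **«Unramified outside `p`» descends to a subfield.**  If every maximal ideal `Q ∌ p` of `𝓞 M` is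
unramified over `ℤ`, then so is every maximal ideal `q ∌ p` of `𝓞 F` for a subfield `F ≤ M`: choose
`Q ⊇ q` in `𝓞 M` (integrality); `p ∉ Q`, and `IsUnramifiedAt` descends along `q = Q ∩ 𝓞 F`
(Mathlib `Algebra.IsUnramifiedAt.of_liesOver`).  The descent step used inside Marcus's Ex. 35
(`isCyclic_of_isUnramifiedAt_of_card_eq_prime_pow`), isolated. [cite: Marcus2018, Ch. 4, Ex. 35 (p. 103)] -/
theorem isUnramifiedAt_intermediateField_of_forall {M : Type*} [Field M] [NumberField M]
    (F : IntermediateField ℚ M) {p : ℕ}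
    (hunr : ∀ (Q : Ideal (𝓞 M)) [Q.IsMaximal], (p : 𝓞 M) ∉ Q → Algebra.IsUnramifiedAt ℤ Q)
    (q : Ideal (𝓞 F)) [q.IsMaximal] (hq : (p : 𝓞 F) ∉ q) : Algebra.IsUnramifiedAt ℤ q := by
  obtain ⟨Q₁, hQ₁max, hQ₁over⟩ := Ideal.exists_maximal_ideal_liesOver_of_isIntegral (S := 𝓞 M) q
  have hpQ₁ : (p : 𝓞 M) ∉ Q₁ := by
    intro hmem
    apply hq
    have : (algebraMap (𝓞 F) (𝓞 M) (p : 𝓞 F)) ∈ Q₁ := by simpa using hmem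
    rwa [← Ideal.mem_comap, ← Ideal.under_def, ← hQ₁over.over] at this
  haveI := hunr Q₁ hpQ₁
  exact Algebra.IsUnramifiedAt.of_liesOver ℤ q Q₁

/-- **A finite Galois extension of `ℚ` of odd `p`-power degree unramified outside `p` has CYCLIC Galois
group** (no abelianness assumed).  Induction on the exponent: for `Gal(M/ℚ) = G` a non-trivial `p`-group
the centre `Z(G)` is non-trivial (`IsPGroup.center_nontrivial`), the fixed field `M^{Z(G)}` is Galois over
`ℚ` with group `G/Z(G)` (`IsGalois.normalAutEquivQuotient`) of smaller `p`-power order and unramified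
outside `p` (`isUnramifiedAt_intermediateField_of_forall`), hence cyclic by induction; then `G` is abelian
(`MonoidHom.isMulCommutative_of_isCyclic_of_ker_le_center`) and Marcus's Ex. 34–35
(`isCyclic_of_isUnramifiedAt_of_card_eq_prime_pow`) concludes.  Equivalently: the maximal pro-`p`
extension of `ℚ` unramified outside `{p, ∞}` has pro-cyclic Galois group (`= ℤ_p`, the cyclotomic
`ℤ_p`-extension) — `ℚ` is `p`-rational for odd `p`.
[cite: Marcus2018, Ch. 4, Ex. 34–36 (pp. 102–103)] [cite: Washington1997, §13.1 and Prop. 13.2] -/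
theorem isCyclic_of_isGalois_of_isUnramifiedAt_of_card_eq_prime_pow {M : Type u} [Field M]
    [NumberField M] [IsGalois ℚ M] {p k : ℕ} (hp : p.Prime) (hp2 : p ≠ 2)
    (hcard : Nat.card (M ≃ₐ[ℚ] M) = p ^ k)
    (hunr : ∀ (Q : Ideal (𝓞 M)) [Q.IsMaximal], (p : 𝓞 M) ∉ Q → Algebra.IsUnramifiedAt ℤ Q) :
    IsCyclic (M ≃ₐ[ℚ] M) := by
  classical
  induction k using Nat.strong_induction_on generalizing M with
  | _ k ih => ?_
  haveI : Fact p.Prime := ⟨hp⟩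
  rcases Nat.eq_zero_or_pos k with rfl | hk
  · -- degree `1`: the trivial group is cyclic
    rw [pow_zero] at hcard
    haveI : Subsingleton (M ≃ₐ[ℚ] M) := (Nat.card_eq_one_iff_unique.mp hcard).1
    exact isCyclic_of_subsingleton
  -- `G` is a non-trivial `p`-group: its centre is non-trivial
  have hG : IsPGroup p (M ≃ₐ[ℚ] M) := IsPGroup.of_card hcard
  haveI : Nontrivial (M ≃ₐ[ℚ] M) := by
    rw [← Finite.one_lt_card_iff_nontrivial, hcard]
    exact Nat.one_lt_pow hk.ne' hp.one_lt
  haveI hZnt : Nontrivial (Subgroup.center (M ≃ₐ[ℚ] M)) := hG.center_nontrivial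
  set Z : Subgroup (M ≃ₐ[ℚ] M) := Subgroup.center (M ≃ₐ[ℚ] M) with hZ
  -- the fixed field of the centre
  set M' : IntermediateField ℚ M := IntermediateField.fixedField Z with hM'
  haveI : IsGalois ℚ M' := IsGalois.of_fixedField_normal_subgroup Z
  let e : (M ≃ₐ[ℚ] M) ⧸ Z ≃* (M' ≃ₐ[ℚ] M') := IsGalois.normalAutEquivQuotient Z
  -- its Galois group has order `p^j` with `j < k`
  have hZcard : 1 < Nat.card Z := Finite.one_lt_card_iff_nontrivial.mpr hZnt
  have hmul : Nat.card Z * Z.index = p ^ k := by rw [Subgroup.card_mul_index, hcard]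
  have hidx_dvd : Z.index ∣ p ^ k := Dvd.intro_left _ hmul
  obtain ⟨j, hjk, hj⟩ := (Nat.dvd_prime_pow hp).mp hidx_dvd
  have hjlt : j < k := by
    by_contra hjk'
    have hjk'' : j = k := le_antisymm hjk (not_lt.mp hjk')
    subst hjk''
    rw [hj] at hmul
    have hpk : 0 < p ^ j := pow_pos hp.pos j
    have : Nat.card Z = 1 := by
      have h := hmul
      nth_rewrite 2 [← one_mul (p ^ j)] at h
      exact Nat.eq_of_mul_eq_mul_right hpk h
    omega
  have hcard' : Nat.card (M' ≃ₐ[ℚ] M') = p ^ j := by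
    rw [← Nat.card_congr e.toEquiv, ← Subgroup.index_eq_card, hj]
  -- `M'` is unramified outside `p`
  have hunr' : ∀ (Q : Ideal (𝓞 M')) [Q.IsMaximal], (p : 𝓞 M') ∉ Q → Algebra.IsUnramifiedAt ℤ Q :=
    fun Q _ hQ => isUnramifiedAt_intermediateField_of_forall M' hunr Q hQ
  -- induction: `Gal(M'/ℚ) ≅ G/Z(G)` is cyclic, hence `G` is abelian
  haveI hcyc' : IsCyclic (M' ≃ₐ[ℚ] M') := ih j hjlt hcard' hunr'
  haveI : IsCyclic ((M ≃ₐ[ℚ] M) ⧸ Z) :=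
    isCyclic_of_surjective e.symm.toMonoidHom e.symm.surjective
  haveI : IsMulCommutative (M ≃ₐ[ℚ] M) :=
    MonoidHom.isMulCommutative_of_isCyclic_of_ker_le_center (QuotientGroup.mk' Z)
      (by rw [QuotientGroup.ker_mk'])
  haveI : IsAbelianGalois ℚ M := { }
  exact isCyclic_of_isUnramifiedAt_of_card_eq_prime_pow hp hp2 hcard hunr

end Literature.NumberTheory.NumberFields

end
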